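import Mathlib

/-!
# Solo (informed) rung s28/5: the conjectural W-line profile (P54) and the structure it forces

Setting (paper §16.12(h)(5), s28 extension; claims c293, c294): for the unramified W-line
`L = K(u_W^{1/7}) ⊂ H_K` of an inert `w = 1` field with `a₁ = 1` the conjectural ray profile is
`V_k^W = 2 + 3⌈k/2⌉ - [k = 5] + N_k(ℓ₃, ℓ₅) - [k = 5]·ν_W` (`T^W = {3, 5}`), i.e. the ramified-line
profile of `soloInformed_ray_profile` shifted by one at every `k` (the decomposition group at the
prime above `7` has order `6` instead of `42`: one global class becomes locally trivial for
`k ≤ 5`, one local invariant appears at `k = 6`).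

* `soloInformed_wline_profile`: the closed form
  `(2, 5, 6, 8 + [ℓ₃ ≥ 2], 9 + [ℓ₃ ≥ 3], 10 + [ℓ₃ ≥ 4] + [ℓ₅ ≥ 2], 11 + [ℓ₃ ≥ 5] + [ℓ₅ ≥ 3])`.
* `soloInformed_wline_forced_reading`: under this formula the universal census vector
  `(2, 5, 6, 8, 9, 10, 11)` (all 17 fields with `a ∈ {(1,1,1), (1,1,2)}`) has exactly the readings
  `(ℓ₃, ℓ₅, ν_W) ∈ {(1, 1, 0), (1, 2, 1)}` — so `ℓ₃^W = 1` is forced, and a field whose W-line has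
  `Cl(F_W)[7] ≠ 0` (a strand through degree `0`, hence `ℓ₅^W ≥ 2`) must have `ν_W = 1`: the
  prediction P54a, confirmed at the three linear fields `d = 239212, 280009, 395928` (classes of
  the primes above `7` in `Cl(F_W)/7`: `[2], [5], [4]`, job j207296).
* `soloInformed_wline_v3_nine`: `V₃^W = 9` iff `ℓ₃ ≥ 2` (the fields `445393`, `467945`).
-/

namespace Summit.Langlands.Langlands.Theorems

open Finset

/-- Closed form of the conjectural `a₁ = 1` W-line profile before the `ν_W`-correction. -/
def soloInformedWProfile (ℓ₃ ℓ₅ k : ℕ) : ℕ :=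
  if k = 0 then 2 else if k = 1 then 5 else if k = 2 then 6
  else if k = 3 then 8 + (if 2 ≤ ℓ₃ then 1 else 0)
  else if k = 4 then 9 + (if 3 ≤ ℓ₃ then 1 else 0)
  else if k = 5 then 10 + (if 4 ≤ ℓ₃ then 1 else 0) + (if 2 ≤ ℓ₅ then 1 else 0)
  else 11 + (if 5 ≤ ℓ₃ then 1 else 0) + (if 3 ≤ ℓ₅ then 1 else 0)

/-- `2 + 3⌈k/2⌉ - [k = 5] + N_k` with the two-strand count `N_k` equals the closed form. -/
theorem soloInformed_wline_profile :
    ∀ ℓ₃ ∈ Icc 1 7, ∀ ℓ₅ ∈ Icc 1 7, ∀ k ≤ 6,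
      2 + 3 * ((k + 1) / 2) - (if k = 5 then 1 else 0)
        + ((range (k + 1)).filter (fun i =>
            ((1 + i) % 6 = 3 ∧ k + 1 - i ≤ ℓ₃) ∨ ((1 + i) % 6 = 5 ∧ k + 1 - i ≤ ℓ₅))).card
        = soloInformedWProfile ℓ₃ ℓ₅ k := by
  decide

/-- The universal W-line vector `(2,5,6,8,9,10,11)`. -/
def soloInformedWVector' (k : ℕ) : ℕ :=
  if k = 0 then 2 else if k = 1 then 5 else if k = 2 then 6 else if k = 3 then 8
  else if k = 4 then 9 else if k = 5 then 10 else 11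

/-- Under P54 the universal vector forces `ℓ₃ = 1` and `(ℓ₅, ν_W) ∈ {(1,0), (2,1)}`. -/
theorem soloInformed_wline_forced_reading :
    ∀ ℓ₃ ∈ Icc 1 7, ∀ ℓ₅ ∈ Icc 1 7, ∀ ν ≤ 1,
      (∀ k ≤ 6, soloInformedWProfile ℓ₃ ℓ₅ k - (if k = 5 then ν else 0) = soloInformedWVector' k)
        ↔ (ℓ₃, ℓ₅, ν) ∈ ({(1, 1, 0), (1, 2, 1)} : Finset (ℕ × ℕ × ℕ)) := by
  decide

/-- `V₃^W = 9` exactly when the `3`-strand has length at least `2`. -/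
theorem soloInformed_wline_v3_nine :
    ∀ ℓ₃ ∈ Icc 1 7, ∀ ℓ₅ ∈ Icc 1 7, soloInformedWProfile ℓ₃ ℓ₅ 3 = 9 ↔ 2 ≤ ℓ₃ := by
  decide

end Summit.Langlands.Langlands.Theorems
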